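import Summits.RiemannHypothesis.RiemannHypothesis.Theorems.JensenPolynomialsSkeletonXi

/-!
# Route `JensenPolynomials` — rung J-P (P1⁺): the skeleton matches the window to SECOND ORDER, and the degree-3 case

**RH-FREE, ξ-free unless marked.** Two structural facts about the skeleton sign test `SkeletonSignTest γ d n`
(`JensenPolynomialsSkeletonDefs`), for an ARBITRARY real sequence `γ` with `γ(n), γ(n+1) ≠ 0` and `κ_n² ≥ 0` resp. `> 0`:

* **Second-order matching** (`windowSeq_one`, `skeletonSeq_one`, `skeletonSeq_two`, `coeff_appellPoly_window_eq_skeleton`,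
  `natDegree_window_sub_skeleton_le`): `r_n(0) = s_n(0) = 1`, `r_n(1) = s_n(1) = 1`, `r_n(2) = s_n(2)` — the choice of the tilt
  `θ_n = 1 − κ_n` and of the Bessel parameter `κ_n² = (b+1)(1 − r_n(2))` makes the skeleton agree with the window in the top
  THREE coefficients, so `deg (P − P⁰) ≤ d − 3`: the algebraic content of the CAL's normalisation `Δb₁ = Δb₂ = 0` (the
  perturbation expansion `P = exp(Σ_{m≥3} Δb_m D^m) P⁰` starts at order `3`).
* **Degree 3** (`window_sub_skeleton_three`, `sameSign_of_cubic`, `skeletonSignTest_three_iff`): for `d = 3` the difference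
  `P − P⁰` is the CONSTANT `r_n(3) − s_n(3)`, so `P` and `P⁰` have the same critical points, and the test at `(3, n)` is
  EQUIVALENT to «the window cubic `X³ + 3X² + 3r_n(2)X + r_n(3)` has three simple real zeros». For `γ = xiTaylorCoeff`
  (`skeletonSignTest_xi_three_iff`) this says: the theory seat's «first kernel rung» P1⁺.0 (`∀ n ≥ 10⁴, SkeletonSignTest ξ 3 n`)
  carries, at `d = 3`, NO content beyond simple real-rootedness of the window cubic (hyperbolicity of `J^{3,n}_ξ` is a tree
  theorem for every `n`; only simplicity of its zeros is not) — the certificate's extra, RH-verification-free content begins at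
  `d = 4`. A finding for the P1⁺ planner, consistent with the DATA (`n_S(3) = 0`: the test holds at every computed `n`).

Nothing here bears on the truth of RH.
-/

noncomputable section
-- D-0017: `Summit.RiemannHypothesis.RiemannHypothesis.…` duplicates the namespace BY DESIGN (single-problem summit).
set_option linter.dupNamespace false

namespace Summit.RiemannHypothesis.RiemannHypothesis.Theorems.JensenPolynomials

open Literature.NumberTheory.LFunctions Polynomial Finset
open scoped BigOperators Nat

/-! ## Second-order matching of window and skeleton -/

/-- `r_n(1) = 1`. -/
theorem windowSeq_one (γ : ℕ → ℝ) (n : ℕ) (hn : γ n ≠ 0) (hn1 : γ (n + 1) ≠ 0) : windowSeq γ n 1 = 1 := by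
  rw [windowSeq]; field_simp

/-- `s_n(1) = θ_n + κ_n = 1`. -/
theorem skeletonSeq_one (γ : ℕ → ℝ) (n : ℕ) : skeletonSeq γ n 1 = 1 := by
  have hb : ((n : ℝ) + 1 / 2) ≠ 0 := by positivity
  rw [skeletonSeq, Finset.sum_range_succ, Finset.sum_range_one, skelTheta]
  simp only [Nat.choose_zero_right, Nat.cast_one, Nat.sub_zero, pow_one, pow_zero, ascPochhammer_zero, eval_one,
    Nat.choose_self, Nat.sub_self, ascPochhammer_one, eval_X]
  field_simp
  ring

/-- `s_n(2) = 1 − κ_n²/(b+1) = r_n(2)` as soon as `κ_n² ≥ 0` (so that `κ_n = √(κ_n²)` squares back). -/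
theorem skeletonSeq_two (γ : ℕ → ℝ) (n : ℕ) (hκ : 0 ≤ skelKappaSq γ n) : skeletonSeq γ n 2 = windowSeq γ n 2 := by
  have hb : ((n : ℝ) + 1 / 2) ≠ 0 := by positivity
  have hb1 : ((n : ℝ) + 1 / 2 + 1) ≠ 0 := by positivity
  have hsq : skelKappa γ n ^ 2 = ((n : ℝ) + 3 / 2) * (1 - windowSeq γ n 2) := by
    rw [skelKappa, Real.sq_sqrt hκ, skelKappaSq]
  rw [skeletonSeq, Finset.sum_range_succ, Finset.sum_range_succ, Finset.sum_range_one, skelTheta]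
  simp only [Nat.choose_zero_right, Nat.cast_one, Nat.sub_zero, pow_zero, ascPochhammer_zero, eval_one,
    Nat.choose_self, Nat.sub_self, ascPochhammer_one, eval_X, ascPochhammer_succ_eval, Nat.cast_one,
    show (2 : ℕ).choose 1 = 2 by rfl, Nat.cast_ofNat, show 2 - 1 = 1 by rfl, pow_one]
  field_simp
  -- polynomial identity in `κ`, using `κ² = (n + 3/2)(1 − r₂)`
  have h32 : ((n : ℝ) + 3 / 2) = (n : ℝ) + 1 / 2 + 1 := by ring
  rw [h32] at hsq
  nlinarith [hsq]

/-- **Second-order matching (coefficients)**: for `γ(n), γ(n+1) ≠ 0` and `κ_n² ≥ 0`, the window Appell polynomial and its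
skeleton have the same coefficients of `X^k` for every `k ≥ d − 2`. -/
theorem coeff_appellPoly_window_eq_skeleton (γ : ℕ → ℝ) (n d : ℕ) (hn : γ n ≠ 0) (hn1 : γ (n + 1) ≠ 0)
    (hκ : 0 ≤ skelKappaSq γ n) {k : ℕ} (hk : d ≤ k + 2) :
    (appellPoly (windowSeq γ n) d).coeff k = (appellPoly (skeletonSeq γ n) d).coeff k := by
  rw [coeff_appellPoly, coeff_appellPoly]
  split_ifs with hkd
  · have hj : d - k = 0 ∨ d - k = 1 ∨ d - k = 2 := by omega
    rcases hj with h | h | h <;> rw [h]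
    · rw [windowSeq_zero γ n hn, skeletonSeq_zero]
    · rw [windowSeq_one γ n hn hn1, skeletonSeq_one]
    · rw [skeletonSeq_two γ n hκ]
  · rfl

/-- **Second-order matching (degree)**: `deg (P − P⁰) ≤ d − 3` — the perturbation `P = F(D)P⁰` starts at order `3`. -/
theorem natDegree_window_sub_skeleton_le (γ : ℕ → ℝ) (n d : ℕ) (hn : γ n ≠ 0) (hn1 : γ (n + 1) ≠ 0)
    (hκ : 0 ≤ skelKappaSq γ n) :
    (appellPoly (windowSeq γ n) d - appellPoly (skeletonSeq γ n) d).natDegree ≤ d - 3 := by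
  refine natDegree_le_iff_coeff_eq_zero.2 fun k hk => ?_
  rw [coeff_sub, coeff_appellPoly_window_eq_skeleton γ n d hn hn1 hκ (by exact_mod_cast (by
    have : ((d : ℕ) - 3 : ℕ) < k := by exact_mod_cast hk
    omega)), sub_self]

/-! ## Degree 3: the test is simple real-rootedness of the window cubic -/

/-- For `d = 3` the window cubic and its skeleton differ by the constant `r_n(3) − s_n(3)`. -/
theorem window_sub_skeleton_three (γ : ℕ → ℝ) (n : ℕ) (hn : γ n ≠ 0) (hn1 : γ (n + 1) ≠ 0)
    (hκ : 0 ≤ skelKappaSq γ n) :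
    appellPoly (windowSeq γ n) 3 - appellPoly (skeletonSeq γ n) 3 = C (windowSeq γ n 3 - skeletonSeq γ n 3) := by
  ext k
  rw [coeff_sub, coeff_C]
  split_ifs with hk
  · subst hk
    rw [coeff_zero_eq_eval_zero, coeff_zero_eq_eval_zero, eval_zero_appellPoly, eval_zero_appellPoly]
  · rw [coeff_appellPoly_window_eq_skeleton γ n 3 hn hn1 hκ (by omega), sub_self]

/-- **Cubic lemma (ξ-free)**: two real cubics with positive leading coefficients which differ by a constant and BOTH have
three simple real zeros take the same sign at each of their (common) critical points. (Rolle places one critical point in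
each root gap; a quadratic has no third zero; the product formula gives the signs `+` at the left and `−` at the right
critical point for both cubics.) -/
theorem sameSign_of_cubic {P Q : ℝ[X]} (hPdeg : P.natDegree = 3) (hQdeg : Q.natDegree = 3)
    (hPlc : 0 < P.leadingCoeff) (hQlc : 0 < Q.leadingCoeff) {δ : ℝ} (hPQ : P - Q = C δ)
    (hPs : P.Splits) (hPnd : P.roots.Nodup) (hQs : Q.Splits) (hQnd : Q.roots.Nodup) :
    ∀ e : ℝ, (derivative Q).eval e = 0 → 0 < P.eval e * Q.eval e := by
  classical
  have hder : derivative P = derivative Q := by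
    have := congrArg derivative hPQ
    rwa [derivative_sub, derivative_C, sub_eq_zero] at this
  -- signs of a simple-rooted cubic with positive leading coefficient at its critical points
  have key : ∀ R : ℝ[X], R.natDegree = 3 → 0 < R.leadingCoeff → R.Splits → R.roots.Nodup →
      ∃ c₁ c₂ : ℝ, c₁ < c₂ ∧ (derivative R).eval c₁ = 0 ∧ (derivative R).eval c₂ = 0 ∧
        0 < R.eval c₁ ∧ R.eval c₂ < 0 ∧ ∀ e, (derivative R).eval e = 0 → e = c₁ ∨ e = c₂ := by
    intro R hRdeg hRlc hRs hRnd
    obtain ⟨x, hx, hReval⟩ := exists_strictMono_roots hRs hRnd hRdeg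
    have hRroot : ∀ i : Fin 3, R.eval (x i) = 0 := fun i => by
      rw [hReval]; exact mul_eq_zero_of_right _ (Finset.prod_eq_zero (Finset.mem_univ i) (sub_self _))
    have h01 : x 0 < x 1 := hx (by decide)
    have h12 : x 1 < x 2 := hx (by decide)
    obtain ⟨c₁, hc₁, hdc₁⟩ := exists_deriv_eq_zero (f := fun t => R.eval t) h01 R.continuous.continuousOn
      (by rw [hRroot, hRroot])
    obtain ⟨c₂, hc₂, hdc₂⟩ := exists_deriv_eq_zero (f := fun t => R.eval t) h12 R.continuous.continuousOn
      (by rw [hRroot, hRroot])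
    rw [Polynomial.deriv] at hdc₁ hdc₂
    have hc12 : c₁ < c₂ := hc₁.2.trans hc₂.1
    -- signs via the product formula
    have hfin : ∀ i : Fin 3, i = 0 ∨ i = 1 ∨ i = 2 := by decide
    have hsign₁ : 0 < R.eval c₁ := by
      rw [hReval]
      have h := sign_prod_sub x c₁ 1 (by norm_num)
        (fun i hi => by rcases hfin i with rfl | rfl | rfl <;> simp_all)
        (fun i hi => by
          rcases hfin i with rfl | rfl | rfl
          · simp at hi
          · exact hc₁.2
          · exact hc₁.2.trans h12)
      norm_num at h
      exact mul_pos hRlc h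
    have hsign₂ : R.eval c₂ < 0 := by
      rw [hReval]
      have h := sign_prod_sub x c₂ 2 (by norm_num)
        (fun i hi => by
          rcases hfin i with rfl | rfl | rfl
          · exact h01.trans hc₂.1
          · exact hc₂.1
          · simp at hi)
        (fun i hi => by rcases hfin i with rfl | rfl | rfl <;> simp_all)
      norm_num at h
      exact mul_neg_of_pos_of_neg hRlc (by linarith)
    refine ⟨c₁, c₂, hc12, hdc₁, hdc₂, hsign₁, hsign₂, fun e he => ?_⟩
    -- a third critical point would give the quadratic `R'` three roots
    by_contra hne
    obtain ⟨hne1, hne2⟩ := not_or.mp hne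
    have hR'ne : derivative R ≠ 0 := by
      intro h0
      have := Polynomial.derivative_eq_zero.mp h0
      omega
    have hR'deg : (derivative R).natDegree ≤ 2 := by
      have := natDegree_derivative_le R; omega
    have hsub : ({c₁, c₂, e} : Finset ℝ).val ≤ (derivative R).roots := by
      rw [Multiset.le_iff_subset (Finset.nodup _)]
      intro y hy
      rw [Finset.mem_val, Finset.mem_insert, Finset.mem_insert, Finset.mem_singleton] at hy
      rw [mem_roots hR'ne, IsRoot.def]
      rcases hy with rfl | rfl | rfl
      · exact hdc₁
      · exact hdc₂
      · exact he
    have hcard : ({c₁, c₂, e} : Finset ℝ).card = 3 := by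
      rw [Finset.card_insert_of_notMem, Finset.card_insert_of_notMem, Finset.card_singleton]
      · simpa using fun h => hne2 h.symm
      · simp only [Finset.mem_insert, Finset.mem_singleton, not_or]
        exact ⟨hc12.ne, fun h => hne1 h.symm⟩
    have h3 : 3 ≤ (derivative R).roots.card := by
      have := Multiset.card_le_card hsub
      rwa [Finset.card_val, hcard] at this
    have := (derivative R).card_roots'
    omega
  obtain ⟨c₁, c₂, hc12, hdP₁, hdP₂, hP₁, hP₂, hPcrit⟩ := key P hPdeg hPlc hPs hPnd
  obtain ⟨c₁', c₂', hc12', -, -, hQ₁, hQ₂, hQcrit⟩ := key Q hQdeg hQlc hQs hQnd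
  rw [hder] at hdP₁ hdP₂ hPcrit
  intro e he
  -- `e`, `c₁`, `c₂` are critical points of `Q`, hence among `c₁' < c₂'`; the orderings force the signs to agree
  rcases hQcrit e he with rfl | rfl
  · rcases hPcrit _ he with h | h
    · rw [h]; exact mul_pos hP₁ (h ▸ hQ₁)
    · -- `c₁' = c₂`: then `c₁ < c₂ = c₁'` is a critical point of `Q` below `c₁'` — impossible
      exfalso
      rcases hQcrit c₁ hdP₁ with h1 | h1
      · rw [h1] at hc12; rw [h] at hc12; exact lt_irrefl _ hc12
      · rw [h1] at hc12; rw [h] at hc12'; exact lt_asymm hc12 hc12'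
  · rcases hPcrit _ he with h | h
    · -- `c₂' = c₁`: then `c₂ > c₁ = c₂'` is a critical point of `Q` above `c₂'` — impossible
      exfalso
      rcases hQcrit c₂ hdP₂ with h2 | h2
      · rw [h2] at hc12; rw [h] at hc12'; exact lt_asymm hc12 hc12'
      · rw [h2] at hc12; rw [h] at hc12; exact lt_irrefl _ hc12
    · rw [h]; exact mul_pos_of_neg_of_neg hP₂ (h ▸ hQ₂)

/-- **Degree 3 (RH-FREE, ξ-free): the skeleton sign test at `(3, n)` is simple real-rootedness of the window cubic.**
For `γ(n), γ(n+1) ≠ 0` and `κ_n > 0`: `SkeletonSignTest γ 3 n ↔ P.Splits ∧ P.roots.Nodup`, `P = appellPoly (windowSeq γ n) 3 =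
X³ + 3X² + 3r_n(2)X + r_n(3)`. (`→` is S1; `←` is the cubic lemma with S2 for the skeleton.) -/
theorem skeletonSignTest_three_iff (γ : ℕ → ℝ) (n : ℕ) (hn : γ n ≠ 0) (hn1 : γ (n + 1) ≠ 0)
    (hκ : 0 < skelKappa γ n) :
    SkeletonSignTest γ 3 n ↔ (appellPoly (windowSeq γ n) 3).Splits ∧ (appellPoly (windowSeq γ n) 3).roots.Nodup := by
  refine ⟨fun h => SkeletonCertificate.splits_nodup h, fun ⟨hPs, hPnd⟩ => ?_⟩
  have hκsq : 0 ≤ skelKappaSq γ n := by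
    by_contra hneg
    rw [skelKappa, Real.sqrt_eq_zero'.mpr (not_le.mp hneg).le] at hκ
    exact lt_irrefl _ hκ
  have hr0 : windowSeq γ n 0 = 1 := windowSeq_zero γ n hn
  have hs0 : skeletonSeq γ n 0 = 1 := skeletonSeq_zero γ n
  have hr0' : windowSeq γ n 0 ≠ 0 := by rw [hr0]; exact one_ne_zero
  have hs0' : skeletonSeq γ n 0 ≠ 0 := by rw [hs0]; exact one_ne_zero
  obtain ⟨hQs, hQnd, hQdeg⟩ := splits_nodup_appellPoly_skeletonSeq γ n 3 hκ
  have hPdeg : (appellPoly (windowSeq γ n) 3).natDegree = 3 := natDegree_appellPoly _ 3 hr0'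
  have hPlc : 0 < (appellPoly (windowSeq γ n) 3).leadingCoeff := by
    rw [leadingCoeff_appellPoly _ 3 hr0', hr0]; exact one_pos
  have hQlc : 0 < (appellPoly (skeletonSeq γ n) 3).leadingCoeff := by
    rw [leadingCoeff_appellPoly _ 3 hs0', hs0]; exact one_pos
  exact
    { natDegree_eq := by rw [hPdeg, hQdeg]
      two_le := by rw [hQdeg]; norm_num
      leadingCoeff_pos := mul_pos hPlc hQlc
      splits := hQs
      nodup := hQnd
      sameSign := sameSign_of_cubic hPdeg hQdeg hPlc hQlc (window_sub_skeleton_three γ n hn hn1 hκsq)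
        hPs hPnd hQs hQnd }

/-- **Degree 3 for `ξ` (RH-FREE)**: `SkeletonSignTest xiTaylorCoeff 3 n` holds iff the window cubic
`X³ + 3X² + 3r_n(2)X + r_n(3)` of `ξ` at shift `n` has three simple real zeros. So the theory seat's first rung P1⁺.0
(`∀ n ≥ 10⁴, SkeletonSignTest ξ 3 n`) is, at `d = 3`, exactly «`J^{3,n}_ξ` has SIMPLE zeros» on that range — its real zeros
being a tree theorem for every `n`; the certificate's extra content begins at `d = 4`. Not proved here for any `n`. -/
theorem skeletonSignTest_xi_three_iff (n : ℕ) :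
    SkeletonSignTest xiTaylorCoeff 3 n ↔
      (appellPoly (windowSeq xiTaylorCoeff n) 3).Splits ∧ (appellPoly (windowSeq xiTaylorCoeff n) 3).roots.Nodup :=
  skeletonSignTest_three_iff xiTaylorCoeff n (xiTaylorCoeff_pos_holds n).ne' (xiTaylorCoeff_pos_holds (n + 1)).ne'
    (skelKappa_xi_pos n)

end Summit.RiemannHypothesis.RiemannHypothesis.Theorems.JensenPolynomials

end
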